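import Literature.NumberTheory.Automorphic.AsaiAtOneOfAsaiHolomorphy
import Literature.NumberTheory.Automorphic.AsaiEulerProductConvergence
import Literature.NumberTheory.Automorphic.PartialAsaiLHolomorphy
import HarnessLib

/-!
# Stub `stub_holTwisted` (W6) of line `Sketch` — the analytic package of a unitary-a.e. cuspidal
# datum on `GL₂(𝔸_E)` from the Grbac–Shahidi holomorphy fact
# (crux `ParityBlindBianchi.QuadraticDescentGL2`, stmt-Langlands-16811)

Skeleton v3, 2026-08-17. The registered stub `stub_holTwisted`: for `E/F` quadratic with involution
`c ≠ 1`, a cuspidal Borel–Jacquet datum `P'` on `GL₂(𝔸_E)` that is unitary almost everywhere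
(`‖∏ t_{P',w}‖ = 1` for almost all `w`), an Asai datum `(S, A')` of `P'`, and GRANTED the named fact
`GrbacShahidi2015_partialAsaiL_holomorphy` (Grbac–Shahidi 2015, Thm. 4.3 (1), (2)(a), `L²` currency,
a HYPOTHESIS here): there is ONE abscissa `σ₀ ≥ 1` beyond which both partial Asai Euler products
`∏_{v ∉ S} det(1 - As^θ(t_v) q_v^{-s})⁻¹` (`θ = ±1`) are multipliable, and ONE radius `δ > 0` such that
for each sign `θ` the function `(s - 1) L^S(s, P', As^θ)` continues holomorphically from `{σ₀ < Re s}`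
to `{1 < Re s} ∪ B(1, δ)`.

Proof: pure repackaging of two PROVED theorems of the tree —
`CuspidalAutomorphicRepData.exists_multipliable_asaiEulerFactors` (both signs, one abscissa `σ₁`;
Borel–Jacquet 5.7 + Jacquet–Shalika (5.1.3)) and, for `θ = 1` and `θ = -1` separately,
`CuspidalAutomorphicRepData.hol_of_asaiHolomorphyL2` (whose hypothesis `hGS` is verbatim the body of
`GrbacShahidi2015_partialAsaiL_holomorphy`), giving `(σ₊, δ₊, G₊)` and `(σ₋, δ₋, G₋)`; then
`σ₀ = max σ₁ (max σ₊ σ₋)`, `δ = min δ₊ δ₋` (the region `{1 < Re s} ∪ B(1, δ)` is monotone in `δ`).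
-/

set_option linter.dupNamespace false -- `Summit.Langlands.Langlands` is the mandated namespace (lakefile weak option)

noncomputable section

open scoped Classical Topology
open NumberField IsDedekindDomain Filter
open Literature.NumberTheory.Automorphic Literature.NumberTheory.GaloisRepresentations

namespace Summit.Langlands.Langlands.Theorems.QuadraticDescentGL2.Sketch

/-- The region `{1 < Re s} ∪ B(1, δ)` grows with `δ`. [folklore] -/
private theorem union_ball_mono {δ δ' : ℝ} (h : δ ≤ δ') :
    ({s : ℂ | 1 < s.re} ∪ Metric.ball (1 : ℂ) δ) ⊆ ({s : ℂ | 1 < s.re} ∪ Metric.ball (1 : ℂ) δ') :=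
  Set.union_subset_union_right _ (Metric.ball_subset_ball h)

/-- **Registered stub `stub_holTwisted` (W6, line `Sketch`, crux stmt-Langlands-16811): the analytic
package of a unitary-a.e. cuspidal datum from the Grbac–Shahidi holomorphy.** For `E/F` quadratic with
involution `c ≠ 1`, a cuspidal `P'` on `GL₂(𝔸_E)` unitary a.e. and an Asai datum `(S, A')` of `P'`:
granted `GrbacShahidi2015_partialAsaiL_holomorphy`, there is ONE abscissa `σ₀ ≥ 1` beyond which both
partial Asai Euler products are multipliable
(`CuspidalAutomorphicRepData.exists_multipliable_asaiEulerFactors`) and ONE `δ > 0` such that for each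
sign `θ` the function `(s - 1) L^S(s, P', As^θ)` continues holomorphically to `{1 < Re s} ∪ B(1, δ)`
(`CuspidalAutomorphicRepData.hol_of_asaiHolomorphyL2` for `θ = ±1`, max of abscissae, min of radii).
[cite: GrbacShahidi2015, Thm. 4.3 (1), (2)(a)] [cite: BorelJacquetCorvallis1979, 5.7] -/
theorem stub_holTwisted :
    ∀ (F E : Type) [Field F] [NumberField F] [Field E] [NumberField E] [Algebra F E] (c : E ≃ₐ[F] E),
      Module.finrank F E = 2 → c ≠ 1 →
      ∀ (hE : isCompact_glFiniteIntegralLevel 2 E) (P' : CuspidalAutomorphicRepData 2 E hE),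
        (∀ᶠ w : HeightOneSpectrum (𝓞 E) in cofinite, ∀ α : Multiset ℂ,
          P'.1.HasSatakeParamAt w α → ‖α.prod‖ = 1) →
        ∀ (S : Set (HeightOneSpectrum (𝓞 F))) (A' : SatakeFamily E), P'.1.IsAsaiDatum c S A' →
        GrbacShahidi2015_partialAsaiL_holomorphy →
        ∃ σ₀ : ℝ, 1 ≤ σ₀ ∧
          (∀ (θ : ℤˣ) (s : ℂ), σ₀ < s.re →
            Multipliable fun v : {v : HeightOneSpectrum (𝓞 F) // v ∉ S} =>
              ((asaiLocalPolynomial c A' θ (placeAbove E v.1)).eval ((v.1.residueCard : ℂ) ^ (-s)))⁻¹) ∧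
          ∃ δ : ℝ, 0 < δ ∧ ∀ θ : ℤˣ, ∃ G : ℂ → ℂ,
            DifferentiableOn ℂ G ({s : ℂ | 1 < s.re} ∪ Metric.ball (1 : ℂ) δ) ∧
            ∀ s : ℂ, σ₀ < s.re → G s = (s - 1) * partialAsaiL S c A' θ s := by
  intro F E _ _ _ _ _ c h2 hc hE P' hu S A' hSA' hGS
  -- (i) one abscissa of multipliability for both signs
  obtain ⟨σ₁, hσ₁, hmul⟩ := P'.exists_multipliable_asaiEulerFactors h2 (c := c) two_pos hSA'
  -- (ii) the continuations of `(s - 1) L^S(s, P', As^θ)` for `θ = 1` and `θ = -1`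
  obtain ⟨σp, -, δp, hδp, Gp, hGpd, hGpe, -⟩ :=
    CuspidalAutomorphicRepData.hol_of_asaiHolomorphyL2 hGS h2 hc P' two_pos hu (1 : ℤˣ) hSA'
  obtain ⟨σm, -, δm, hδm, Gm, hGmd, hGme, -⟩ :=
    CuspidalAutomorphicRepData.hol_of_asaiHolomorphyL2 hGS h2 hc P' two_pos hu (-1 : ℤˣ) hSA'
  refine ⟨max σ₁ (max σp σm), le_max_of_le_left hσ₁,
    fun θ s hs => hmul θ s (lt_of_le_of_lt (le_max_left _ _) hs),
    min δp δm, lt_min hδp hδm, fun θ => ?_⟩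
  rcases Int.units_eq_one_or θ with rfl | rfl
  · exact ⟨Gp, hGpd.mono (union_ball_mono (min_le_left _ _)),
      fun s hs => hGpe s (lt_of_le_of_lt ((le_max_left _ _).trans (le_max_right _ _)) hs)⟩
  · exact ⟨Gm, hGmd.mono (union_ball_mono (min_le_right _ _)),
      fun s hs => hGme s (lt_of_le_of_lt ((le_max_right _ _).trans (le_max_right _ _)) hs)⟩

end Summit.Langlands.Langlands.Theorems.QuadraticDescentGL2.Sketch

end
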